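import Literature.NumberTheory.ModularForms.ModularCurveCuspFrames
import HarnessLib

/-!
# The invariant height of a finite-index subgroup of `SL₂(ℤ)` in its cusp frames, and its continuity
# (Iwaniec §2.6 (2.42)–(2.43), §2.2 (2.3)–(2.5))

Layer `Literature/NumberTheory/ModularForms`, namespace `Literature.NumberTheory.ModularForms.ModularCurve`;
sequel of `ModularCurveCuspFrames` (the chosen cusp frames `σ_i = frame Γ i` of `Γ± = (↑Γ).adjoinNegOne` for a
finite-index `Γ ≤ SL₂(ℤ)`). Second brick of the construction of the compact Riemann surface `X(Γ)`
(Shimura §1.5; Diamond–Shurman §2.4): the function that measures «how far into a cusp» a point of `Γ∖ℍ` is.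

* `height Γ = y_{Γ±}` — Iwaniec's invariant height (2.42) `max_i max_{γ ∈ Γ±} Im σ_i⁻¹γz` in the chosen frame
  (the tree's `Fuchsian.invHeight`), with its `Γ`-invariance (`height_smul`), the sector formula
  `height (σ_i w) = Im w` for `Im w ≥ 1` (`height_frameGL_smul`), positivity, attainment, «points of height `> Y`
  lie in a sector `σ_i{Im > Y}`» (`exists_smul_eq_frameGL_smul_of_lt_height`) and «points of height `≤ Y` are
  `Γ`-equivalent to a fixed compact set» (`exists_isCompact_smul_mem_of_height_le`) — all specialisations of
  `FuchsianInvariantHeight`;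
* ★ `continuous_height` — **the invariant height is continuous** (not in the tree before): at a point of
  maximal height `w₀ = σ_i⁻¹γ₀z₀` every competing height is `Im g w` for a `g ∈ SL₂(ℝ)` not raising `w₀`, and
  for those `|cw + d| ≥ |cw₀ + d|(1 − ‖w − w₀‖/Im w₀)` uniformly (`im_smul_le_of_im_smul_le`), so
  `Im σ_i⁻¹γ₀z ≤ y_Γ(z) ≤ (Im w₀ + t)/(1 − t/Im w₀)²`, `t = ‖σ_i⁻¹γ₀z − w₀‖ → 0`.

Everything is proved; one definition (`height`, an abbreviation of the tree's `invHeight` at the chosen frame);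
no named facts, no instances.

## References

* H. Iwaniec, *Spectral methods of automorphic forms*, 2nd ed., GSM 53 (2002), §2.2 (2.3)–(2.5), §2.6
  (2.42)–(2.43). [Iwaniec2002]
* G. Shimura, *Introduction to the arithmetic theory of automorphic functions* (1971), §1.5. [ShimuraIATAF1971]
-/

noncomputable section

open scoped MatrixGroups Pointwise Topology
open Set Filter Function UpperHalfPlane
open Literature.NumberTheory.Automorphic Literature.NumberTheory.Automorphic.Fuchsian

namespace Literature.NumberTheory.ModularForms

namespace ModularCurve

variable (Γ : Subgroup SL(2, ℤ))

/-! ### The invariant height of `Γ` in the chosen frame -/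

section Height

variable [Γ.FiniteIndex]

/-- **The invariant height** `y_Γ(z) = max_i max_{γ ∈ Γ±} Im σ_i⁻¹γz` of Iwaniec (2.42), for the chosen frame.
[cite: Iwaniec2002, §2.6 (2.42)] -/
def height (z : ℍ) : ℝ := invHeight (pm Γ) (frame Γ) z

/-- Unfolding `height`. [cite: Iwaniec2002, §2.6 (2.42)] -/
theorem height_def (z : ℍ) : height Γ z = invHeight (pm Γ) (frame Γ) z := rfl

/-- **`Γ`-invariance**: `y_Γ(γz) = y_Γ(z)`. [cite: Iwaniec2002, §2.6 (2.42)] -/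
theorem height_smul {γ : GL (Fin 2) ℝ} (hγ : γ ∈ (Γ : Subgroup (GL (Fin 2) ℝ))) (z : ℍ) :
    height Γ (γ • z) = height Γ z :=
  invHeight_smul (σ := frame Γ) (le_pm Γ hγ) z

/-- `Γ±`-invariance. [cite: Iwaniec2002, §2.6 (2.42)] -/
theorem height_smul_of_mem_pm {γ : GL (Fin 2) ℝ} (hγ : γ ∈ pm Γ) (z : ℍ) : height Γ (γ • z) = height Γ z :=
  invHeight_smul (σ := frame Γ) hγ z

/-- The frame heights are bounded by the invariant height: `Im σ_i⁻¹ z ≤ y_Γ(z)`. [cite: Iwaniec2002, §2.6 (2.42)] -/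
theorem im_inv_frameGL_smul_le_height (i : Fin (numCusps Γ)) (z : ℍ) : ((frameGL Γ i)⁻¹ • z).im ≤ height Γ z :=
  im_frame_le_invHeight (pm_le_range_toGL Γ) (isDiscreteSubgroup_pm Γ) (strictPeriods_frame Γ) i z

/-- `Im σ_i⁻¹ γ z ≤ y_Γ(z)` for `γ ∈ Γ±`. [cite: Iwaniec2002, §2.6 (2.42)] -/
theorem im_inv_frameGL_smul_smul_le_height (i : Fin (numCusps Γ)) {γ : GL (Fin 2) ℝ} (hγ : γ ∈ pm Γ) (z : ℍ) :
    ((frameGL Γ i)⁻¹ • γ • z).im ≤ height Γ z :=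
  im_frame_smul_le_invHeight (pm_le_range_toGL Γ) (isDiscreteSubgroup_pm Γ) (strictPeriods_frame Γ) i hγ z

/-- **The height in a sector is the frame height**: `y_Γ(σ_i w) = Im w` for `Im w ≥ 1`.
[cite: Iwaniec2002, §2.6 (2.42) and §2.2 (2.3)] -/
theorem height_frameGL_smul (i : Fin (numCusps Γ)) {w : ℍ} (hw : 1 ≤ w.im) : height Γ (frameGL Γ i • w) = w.im :=
  invHeight_frame_smul (pm_le_range_toGL Γ) (neg_one_mem_pm Γ) (isDiscreteSubgroup_pm Γ) (frameGL_smul_infty Γ)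
    (strictPeriods_frame Γ) (cusp_inequivalent_pm' Γ) i hw

/-- The height is attained: `y_Γ(z) = Im σ_i⁻¹ γ z` for some `i` and `γ ∈ Γ`. [cite: Iwaniec2002, §2.6 (2.42)] -/
theorem exists_height_eq (z : ℍ) :
    ∃ i, ∃ γ ∈ (Γ : Subgroup (GL (Fin 2) ℝ)), height Γ z = ((frameGL Γ i)⁻¹ • γ • z).im := by
  obtain ⟨i₀⟩ := nonempty_fin_numCusps Γ
  obtain ⟨i, γ, hγ, e⟩ := exists_invHeight_eq (pm_le_range_toGL Γ) (isDiscreteSubgroup_pm Γ) (strictPeriods_frame Γ) i₀ z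
  obtain ⟨γ', hγ', e'⟩ := exists_mem_coe_smul_eq_of_mem_pm Γ hγ
  exact ⟨i, γ', hγ', by rw [height_def, e, e']⟩

/-- The height is positive. [cite: Iwaniec2002, §2.6 (2.43)] -/
theorem height_pos (z : ℍ) : 0 < height Γ z := by
  obtain ⟨i, γ, -, e⟩ := exists_height_eq Γ z
  rw [e]
  exact UpperHalfPlane.im_pos _

/-- **Points of large height lie in a sector**: if `y_Γ(z) > Y ≥ 0` then `γz = σ_i w` with `Im w > Y` for some
`γ ∈ Γ`. [cite: Iwaniec2002, §2.2 (2.3)–(2.5)] -/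
theorem exists_smul_eq_frameGL_smul_of_lt_height {Y : ℝ} (hY : 0 ≤ Y) {z : ℍ} (h : Y < height Γ z) :
    ∃ γ ∈ (Γ : Subgroup (GL (Fin 2) ℝ)), ∃ i, ∃ w : ℍ, Y < w.im ∧ γ • z = frameGL Γ i • w := by
  obtain ⟨γ, hγ, i, u, hu, e⟩ := exists_smul_mem_cuspStrip_of_lt (strictPeriods_frame Γ) hY h
  obtain ⟨γ', hγ', e'⟩ := exists_mem_coe_smul_eq_of_mem_pm Γ hγ
  exact ⟨γ', hγ', i, u, hu.2.2, by rw [e', ← e]⟩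

/-- **Points of bounded height are `Γ`-equivalent to a fixed compact set** (Iwaniec (2.5)).
[cite: Iwaniec2002, §2.2 (2.5) and Prop. 2.3] -/
theorem exists_isCompact_smul_mem_of_height_le (Y : ℝ) :
    ∃ K : Set ℍ, IsCompact K ∧ ∀ z : ℍ, height Γ z ≤ Y → ∃ γ ∈ (Γ : Subgroup (GL (Fin 2) ℝ)), γ • z ∈ K := by
  obtain ⟨F, hF, hvol⟩ := exists_isHypFundamentalDomain_pm Γ
  obtain ⟨K, hK, h⟩ := exists_compact_of_invHeight_le (pm_le_range_toGL Γ) (neg_one_mem_pm Γ) (isDiscreteSubgroup_pm Γ)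
    hF hvol (frameGL_smul_infty Γ) (strictPeriods_frame Γ) (cusp_complete_pm Γ) Y
  refine ⟨K, hK, fun z hz => ?_⟩
  obtain ⟨γ, hγ, hγz⟩ := h z hz
  obtain ⟨γ', hγ', e'⟩ := exists_mem_coe_smul_eq_of_mem_pm Γ hγ
  exact ⟨γ', hγ', by rw [e']; exact hγz⟩

/-- **Key estimate for the continuity of the height.** If `g ∈ SL₂(ℝ)` does not raise `w₀`
(`Im g w₀ ≤ Im w₀`, so `|c w₀ + d| ≥ 1`), then for `‖w − w₀‖ = t < Im w₀`:
`Im g w ≤ (Im w₀ + t) / (1 − t / Im w₀)²` — uniformly in `g`, because `|c| Im w₀ ≤ |c w₀ + d|` gives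
`|c w + d| ≥ |c w₀ + d| (1 − t / Im w₀)` (the elementary estimate behind the continuity of
`y_Γ`; `Im gz = Im z / |cz + d|²`). [cite: Iwaniec2002, §1.1 (1.4) and §2.6 (2.42)] -/
theorem im_smul_le_of_im_smul_le (g : SL(2, ℝ)) {w₀ w : ℍ}
    (hg : ((Matrix.SpecialLinearGroup.toGL g : GL (Fin 2) ℝ) • w₀).im ≤ w₀.im)
    (ht : ‖(w : ℂ) - w₀‖ < w₀.im) :
    ((Matrix.SpecialLinearGroup.toGL g : GL (Fin 2) ℝ) • w).im ≤
      (w₀.im + ‖(w : ℂ) - w₀‖) / (1 - ‖(w : ℂ) - w₀‖ / w₀.im) ^ 2 := by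
  set G : GL (Fin 2) ℝ := Matrix.SpecialLinearGroup.toGL g with hG
  set t : ℝ := ‖(w : ℂ) - w₀‖ with ht_def
  have hy₀ : 0 < w₀.im := w₀.im_pos
  have hdet : |G.det.val| = 1 := by simp [hG]
  have hden₀ : (G • w₀).im = w₀.im / Complex.normSq (denom G w₀) := by
    rw [im_smul_eq_div_normSq, hdet, one_mul]
  have hden : (G • w).im = w.im / Complex.normSq (denom G w) := by
    rw [im_smul_eq_div_normSq, hdet, one_mul]
  have hD₀pos : 0 < Complex.normSq (denom G w₀) := Complex.normSq_pos.mpr (denom_ne_zero G w₀)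
  -- `normSq (c w₀ + d) ≥ 1`
  have hD₀ : 1 ≤ Complex.normSq (denom G w₀) := by
    rw [hden₀, div_le_iff₀ hD₀pos] at hg
    nlinarith
  have habs₀ : 1 ≤ ‖denom G w₀‖ := by
    have : ‖denom G w₀‖ ^ 2 = Complex.normSq (denom G w₀) := Complex.sq_norm _
    nlinarith [norm_nonneg (denom G w₀)]
  -- `|c| Im w₀ ≤ |c w₀ + d|`
  have hc : |(G 1 0 : ℝ)| * w₀.im ≤ ‖denom G w₀‖ := by
    have him : (denom G w₀).im = (G 1 0 : ℝ) * w₀.im := by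
      simp [denom, Complex.add_im, Complex.mul_im]
    calc |(G 1 0 : ℝ)| * w₀.im = |(denom G w₀).im| := by rw [him, abs_mul, abs_of_pos hy₀]
      _ ≤ ‖denom G w₀‖ := Complex.abs_im_le_norm _
  -- `denom G w = denom G w₀ + c (w - w₀)`
  have hsplit : denom G w = denom G w₀ + (G 1 0 : ℝ) * ((w : ℂ) - w₀) := by
    simp only [denom]; ring
  have hs : 0 < 1 - t / w₀.im := by
    rw [sub_pos, div_lt_one hy₀]; exact ht
  -- the lower bound for `|c w + d|`
  have hlow : 1 - t / w₀.im ≤ ‖denom G w‖ := by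
    have h1 : ‖denom G w‖ ≥ ‖denom G w₀‖ - ‖((G 1 0 : ℝ) : ℂ) * ((w : ℂ) - w₀)‖ := by
      rw [hsplit]; exact norm_sub_le_norm_add _ _ |>.trans' le_rfl |> fun h => by
        have := norm_add_le (denom G w₀ + (G 1 0 : ℝ) * ((w : ℂ) - w₀)) (-(((G 1 0 : ℝ) : ℂ) * ((w : ℂ) - w₀)))
        simp only [add_neg_cancel_right, norm_neg] at this
        linarith
    have h2 : ‖((G 1 0 : ℝ) : ℂ) * ((w : ℂ) - w₀)‖ = |(G 1 0 : ℝ)| * t := by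
      rw [norm_mul, Complex.norm_real, Real.norm_eq_abs]
    have h3 : |(G 1 0 : ℝ)| * t ≤ ‖denom G w₀‖ * (t / w₀.im) := by
      have := mul_le_mul_of_nonneg_right hc (div_nonneg (norm_nonneg _) hy₀.le : 0 ≤ t / w₀.im)
      calc |(G 1 0 : ℝ)| * t = |(G 1 0 : ℝ)| * w₀.im * (t / w₀.im) := by field_simp
        _ ≤ ‖denom G w₀‖ * (t / w₀.im) := this
    have h4 : ‖denom G w₀‖ * (1 - t / w₀.im) ≤ ‖denom G w‖ := by nlinarith
    calc 1 - t / w₀.im = 1 * (1 - t / w₀.im) := (one_mul _).symm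
      _ ≤ ‖denom G w₀‖ * (1 - t / w₀.im) := mul_le_mul_of_nonneg_right habs₀ hs.le
      _ ≤ ‖denom G w‖ := h4
  have hlow2 : (1 - t / w₀.im) ^ 2 ≤ Complex.normSq (denom G w) := by
    rw [← Complex.sq_norm]
    exact pow_le_pow_left₀ hs.le hlow 2
  -- `Im w ≤ Im w₀ + t`
  have him : w.im ≤ w₀.im + t := by
    have : |(w : ℂ).im - (w₀ : ℂ).im| ≤ t := by
      rw [← Complex.sub_im]; exact Complex.abs_im_le_norm _
    have h := (abs_le.mp this).2
    simp only [UpperHalfPlane.coe_im] at h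
    linarith
  rw [hden, div_le_div_iff₀ (Complex.normSq_pos.mpr (denom_ne_zero G w)) (pow_pos hs 2)]
  calc w.im * (1 - t / w₀.im) ^ 2 ≤ (w₀.im + t) * (1 - t / w₀.im) ^ 2 :=
        mul_le_mul_of_nonneg_right him (sq_nonneg _)
    _ ≤ (w₀.im + t) * Complex.normSq (denom G w) :=
        mul_le_mul_of_nonneg_left hlow2 (by positivity)

/-- ★ **The invariant height is continuous.** At `z₀`, write `y_Γ(z₀) = Im w₀`, `w₀ = σ_i⁻¹ γ₀ z₀`
(a maximal point); then `y_Γ(z) ≥ Im σ_i⁻¹ γ₀ z → Im w₀`, and every height of `z` is `Im g w`,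
`w = σ_i⁻¹ γ₀ z`, for some `g ∈ SL₂(ℝ)` not raising `w₀`, so `y_Γ(z) ≤ (Im w₀ + t)/(1 − t/Im w₀)²`,
`t = ‖w − w₀‖ → 0`. [cite: Iwaniec2002, §2.6 (2.42)] -/
theorem continuous_height : Continuous (height Γ) := by
  classical
  have hΓ := pm_le_range_toGL Γ
  have hd := isDiscreteSubgroup_pm Γ
  have hper := strictPeriods_frame Γ
  obtain ⟨i₀⟩ := nonempty_fin_numCusps Γ
  refine continuous_iff_continuousAt.2 fun z₀ => ?_
  obtain ⟨i, γ₀, hγ₀, hmax⟩ := exists_invHeight_eq hΓ hd hper i₀ z₀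
  set S : GL (Fin 2) ℝ := frameGL Γ i with hS
  let φ : ℍ → ℍ := fun z => S⁻¹ • γ₀ • z
  have hφc : Continuous φ := (continuous_const_smul _).comp (continuous_const_smul _)
  set w₀ : ℍ := φ z₀ with hw₀
  have hy : height Γ z₀ = w₀.im := hmax
  have hy₀ : 0 < w₀.im := w₀.im_pos
  -- every height of `z` is `Im g (φ z)` for a `g` not raising `w₀`
  have hupper : ∀ z : ℍ, ‖(φ z : ℂ) - w₀‖ < w₀.im →
      height Γ z ≤ (w₀.im + ‖(φ z : ℂ) - w₀‖) / (1 - ‖(φ z : ℂ) - w₀‖ / w₀.im) ^ 2 := by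
    intro z hz
    have hne : (heightSet (pm Γ) (frame Γ) z).Nonempty := heightSet_nonempty i z
    refine csSup_le hne ?_
    rintro y ⟨j, γ, hγ, rfl⟩
    -- `σ_j⁻¹ γ z = g (φ z)` with `g = σ_j⁻¹ γ γ₀⁻¹ σ_i`
    have hmem : (frameGL Γ j)⁻¹ * γ * γ₀⁻¹ * S ∈ (Matrix.SpecialLinearGroup.toGL : SL(2, ℝ) →* GL (Fin 2) ℝ).range := by
      refine Subgroup.mul_mem _ (Subgroup.mul_mem _ (Subgroup.mul_mem _ (Subgroup.inv_mem _ ⟨_, rfl⟩) (hΓ hγ))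
        (Subgroup.inv_mem _ (hΓ hγ₀))) ⟨_, rfl⟩
    obtain ⟨g, hg⟩ := hmem
    have e1 : (frameGL Γ j)⁻¹ • γ • z = (Matrix.SpecialLinearGroup.toGL g : GL (Fin 2) ℝ) • φ z := by
      have : (frameGL Γ j)⁻¹ • γ • z = ((frameGL Γ j)⁻¹ * γ * γ₀⁻¹ * S) • S⁻¹ • γ₀ • z := by
        simp only [smul_smul]; congr 1; group
      rw [this, hg]
    have e0 : (Matrix.SpecialLinearGroup.toGL g : GL (Fin 2) ℝ) • w₀ = (frameGL Γ j)⁻¹ • γ • z₀ := by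
      have : (frameGL Γ j)⁻¹ • γ • z₀ = ((frameGL Γ j)⁻¹ * γ * γ₀⁻¹ * S) • S⁻¹ • γ₀ • z₀ := by
        simp only [smul_smul]; congr 1; group
      rw [this, hg]
    have hg0 : ((Matrix.SpecialLinearGroup.toGL g : GL (Fin 2) ℝ) • w₀).im ≤ w₀.im := by
      rw [e0, ← hy]
      exact im_inv_frameGL_smul_smul_le_height Γ j hγ z₀
    rw [e1]
    exact im_smul_le_of_im_smul_le g hg0 hz
  have hlower : ∀ z : ℍ, (φ z).im ≤ height Γ z := fun z => im_inv_frameGL_smul_smul_le_height Γ i hγ₀ z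
  -- conclude with the squeeze
  rw [ContinuousAt, hy]
  have ht : Tendsto (fun z => ‖(φ z : ℂ) - w₀‖) (𝓝 z₀) (𝓝 0) := by
    have : Tendsto (fun z => (φ z : ℂ)) (𝓝 z₀) (𝓝 (w₀ : ℂ)) :=
      (UpperHalfPlane.continuous_coe.comp hφc).continuousAt
    simpa using (tendsto_iff_norm_sub_tendsto_zero.mp this)
  have hbound : Tendsto (fun z => (w₀.im + ‖(φ z : ℂ) - w₀‖) / (1 - ‖(φ z : ℂ) - w₀‖ / w₀.im) ^ 2) (𝓝 z₀) (𝓝 w₀.im) := by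
    have h1 : Tendsto (fun z => w₀.im + ‖(φ z : ℂ) - w₀‖) (𝓝 z₀) (𝓝 w₀.im) := by
      simpa using tendsto_const_nhds.add ht
    have h2 : Tendsto (fun z => (1 - ‖(φ z : ℂ) - w₀‖ / w₀.im) ^ 2) (𝓝 z₀) (𝓝 1) := by
      have := (tendsto_const_nhds (x := (1 : ℝ))).sub (ht.div_const w₀.im)
      simpa using this.pow 2
    have h3 := h1.div h2 one_ne_zero
    rw [div_one] at h3
    exact h3
  have hlow : Tendsto (fun z => (φ z).im) (𝓝 z₀) (𝓝 w₀.im) :=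
    (UpperHalfPlane.continuous_im.comp hφc).continuousAt
  refine tendsto_of_tendsto_of_tendsto_of_le_of_le' hlow hbound (Eventually.of_forall hlower) ?_
  have hev : ∀ᶠ z in 𝓝 z₀, ‖(φ z : ℂ) - w₀‖ < w₀.im := ht.eventually (gt_mem_nhds hy₀)
  exact hev.mono fun z hz => hupper z hz

end Height

end ModularCurve

end Literature.NumberTheory.ModularForms

end
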